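import Summits.Ventures.PercRepro.RankLevelSetRuleQEightCertLo
import Summits.Ventures.PercRepro.RankLevelSetRuleQEightCertHi

/-!
# PercRepro — THE FAMILY `k = 8` ON ITS WHOLE UNTRUNCATED REGIME, FOR EVERY `q` (p4, gen 24; C-044; paper
proofs/P4-CELL-THREE.md §13.5)

**`rhat_eight_whole (q m : ℕ) (hm : m + 7 ≤ q) : phiK (q + 8) q ≤ rhat q 8 m`** — Rule Q's equal split pays `Φ(q+8, q)` to
EVERY member of EVERY cell `(q+8, q)` with `#P ≤ q − 7` (the whole untruncated regime `u = q − #P ≥ k − 1`), uniformly in `q`.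
The same proof as RankLevelSetRuleQFiveWhole (paper §13): `(R̂ − Φ)·den = na·S(q,m) + nb` (**`rhat_eight_key`**) with the master
sum `S` of RankLevelSetRuleQSumS, the two-sided continued-fraction bounds `C_11 ≤ S ≤ C_13` (`C_11` resp. `C_13` from the
tree or proved here as a sub- or super-solution of the recurrence), and the two certificates `na·C_11 + nb ≥ 0`,
`na·C_13 + nb ≥ 0` (polynomials with non-negative coefficients in `(q−m−7, m)`).  No `sorry`; axioms standard.
-/

namespace PercRepro

open Finset

/-- The lower certificate is non-negative for `a, b ≥ 0`. -/
lemma eight_lower_cert_nonneg (a b : ℚ) (ha : 0 ≤ a) (hb : 0 ≤ b) :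
    0 ≤ naEight (a + b + 7) b * cfElevenN (a + b + 7) b + nbEight (a + b + 7) b * cfElevenD (a + b + 7) b := by
  rw [eight_lower_cert]; positivity

/-- The upper certificate is non-negative for `a, b ≥ 0`. -/
lemma eight_upper_cert_nonneg (a b : ℚ) (ha : 0 ≤ a) (hb : 0 ≤ b) :
    0 ≤ naEight (a + b + 7) b * cfThirteenN (a + b + 7) b + nbEight (a + b + 7) b * cfThirteenD (a + b + 7) b := by
  rw [eight_upper_cert]; positivity

/-- `na·C_11 + nb ≥ 0` on the untruncated regime. -/
lemma eight_lower_nonneg (q m : ℕ) (hm : m + 7 ≤ q) :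
    0 ≤ naEight q m * (cfElevenN q m / cfElevenD q m) + nbEight q m := by
  have hD := cfElevenD_pos q m (by positivity) (by exact_mod_cast (show m + 1 ≤ q by omega))
  have ha : (0 : ℚ) ≤ (q : ℚ) - m - 7 := by
    have : ((m + 7 : ℕ) : ℚ) ≤ q := by exact_mod_cast hm
    push_cast at this; linarith
  have key := eight_lower_cert_nonneg ((q : ℚ) - m - 7) m ha (by positivity)
  rw [show (q : ℚ) - m - 7 + m + 7 = q by ring] at key
  have e : naEight q m * (cfElevenN q m / cfElevenD q m) + nbEight q m
      = (naEight q m * cfElevenN q m + nbEight q m * cfElevenD q m) / cfElevenD q m := by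
    rw [eq_div_iff hD.ne']; ring_nf; field_simp
  rw [e]
  exact div_nonneg key hD.le

/-- `na·C_13 + nb ≥ 0` on the untruncated regime. -/
lemma eight_upper_nonneg (q m : ℕ) (hm : m + 7 ≤ q) :
    0 ≤ naEight q m * (cfThirteenN q m / cfThirteenD q m) + nbEight q m := by
  have hD := cfThirteenD_pos q m (by positivity) (by exact_mod_cast (show m + 1 ≤ q by omega))
  have ha : (0 : ℚ) ≤ (q : ℚ) - m - 7 := by
    have : ((m + 7 : ℕ) : ℚ) ≤ q := by exact_mod_cast hm
    push_cast at this; linarith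
  have key := eight_upper_cert_nonneg ((q : ℚ) - m - 7) m ha (by positivity)
  rw [show (q : ℚ) - m - 7 + m + 7 = q by ring] at key
  have e : naEight q m * (cfThirteenN q m / cfThirteenD q m) + nbEight q m
      = (naEight q m * cfThirteenN q m + nbEight q m * cfThirteenD q m) / cfThirteenD q m := by
    rw [eq_div_iff hD.ne']; ring_nf; field_simp
  rw [e]
  exact div_nonneg key hD.le

/-- **THE FAMILY `k = 8` ON ITS WHOLE UNTRUNCATED REGIME, FOR EVERY `q`**: `Φ(q+8, q) ≤ R̂(q, 8, m)` for every `m ≤ q − 7`. -/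
theorem rhat_eight_whole (q m : ℕ) (hm : m + 7 ≤ q) : phiK (q + 8) q ≤ rhat q 8 m := by
  have hkey := rhat_eight_key q m hm
  have hden := denEight_pos q m
  have hlo := cfEleven_le_sumS q m (by omega)
  have hhi := sumS_le_cfThirteen q m (by omega)
  have hL := eight_lower_nonneg q m hm
  have hU := eight_upper_nonneg q m hm
  have hmain : 0 ≤ naEight q m * sumS q m + nbEight q m := by
    rcases le_total 0 (naEight q m) with hA | hA
    · calc (0 : ℚ) ≤ naEight q m * (cfElevenN q m / cfElevenD q m) + nbEight q m := hL
        _ ≤ naEight q m * sumS q m + nbEight q m := by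
          gcongr
    · calc (0 : ℚ) ≤ naEight q m * (cfThirteenN q m / cfThirteenD q m) + nbEight q m := hU
        _ ≤ naEight q m * sumS q m + nbEight q m := by
          have := mul_le_mul_of_nonpos_left hhi hA
          linarith
  rw [← sub_nonneg]
  rw [← hkey] at hmain
  exact nonneg_of_mul_nonneg_left hmain hden

/-- The matroid form: Rule Q's equal split pays `Φ(q+8,q)` to every member of every cell `(q+8, q)` with `#P ≤ q − 7`
(the whole untruncated regime of the family `k = 8`), for every `q`. -/
theorem ruleQRecv_ge_eight_whole (q m : ℕ) (hm : m + 7 ≤ q) : phiK (q + 8) q ≤ rhat q 8 m :=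
  rhat_eight_whole q m hm

end PercRepro
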